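import Summits.Parity.GeneralizedHardyLittlewood.Theses.DicksonFibration
import Summits.Parity.GeneralizedHardyLittlewood.Theses.LeeYangFibres
import Summits.Parity.GeneralizedHardyLittlewood.Theorems.PairsToGHL.Negative.UnboundedSiegelZeros
import Literature.Barriers.Parity.SiegelZeroDichotomyNoSiegelZeros

/-!
# Crux `DimOne` (stmt-Parity-0819) — crux-strategist sketch (planner-cstrat-stmt-Parity-0819-h1-0, 2026-08-17)

Typed companions of `STRATEGY-CENSUS.md` (this crux's `Cruxes/DimOne/` workfile): the position of the
node, the strengthening `S⁺`, the typed splits, and the negation by-product.  Nothing here is a line or a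
stub; every `theorem` is a real proof (no `sorry`).
-/

namespace Summit.Parity.GeneralizedHardyLittlewood.Cruxes.DimOne.Strategist

open Literature.NumberTheory.Sieve Literature.Barriers.Parity
open Summit.Parity.GeneralizedHardyLittlewood.Theses

noncomputable section

/-! ## §0 Position: the crux is the summit conjunct -/

/-- `DimOne ↔ GeneralizedHardyLittlewood` (→ is the PROVED fibration lemma `Assembly_holds`,
← is the specialisation `d := 1`). [folklore] -/
theorem dimOne_iff_ghl : DicksonFibration.DimOne ↔ _root_.GeneralizedHardyLittlewood := by
  refine ⟨DicksonFibration.Assembly_holds, fun h t L ht ε hε => ?_⟩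
  obtain ⟨N₀, hN₀⟩ := h 1 t L le_rfl ht ε hε
  refine ⟨N₀, fun N hN Ψ hΨ hL K hK hKN => ?_⟩
  simpa using hN₀ N hN Ψ hΨ hL K hK hKN

/-! ## §N Negation by-product: the only refuting mechanism in print is an exceptional zero -/

/-- Modulo the vendored Matomäki–Merikoski Theorem 1.3: Siegel zeros of unbounded quality refute
`DimOne` (system `(n, n + 2q)`, `N = q^{10}`, `L = 3`; the tree's
`PairsToGHL.Negative.not_generalizedHardyLittlewood_of_unboundedSiegelZeros` composed with the proved
fibration lemma). [cite: MatomakiMerikoski2023, Theorem 1.3] -/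
theorem not_dimOne_of_unboundedSiegelZeros (hMM : MatomakiMerikoski2023_pairCorrelation)
    (hU : UnboundedSiegelZeros) : ¬ DicksonFibration.DimOne := fun hD =>
  Theorems.PairsToGHL.Negative.not_generalizedHardyLittlewood_of_unboundedSiegelZeros hMM hU
    (DicksonFibration.Assembly_holds hD)

/-- Hence (mod MM Thm 1.3) any proof of the crux is a Landau–Siegel theorem: `DimOne → NoSiegelZeros`
(rh.S34, the tree's open no-Siegel-zero statement). [cite: MatomakiMerikoski2023, Theorem 1.3] -/
theorem noSiegelZeros_of_dimOne (hMM : MatomakiMerikoski2023_pairCorrelation)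
    (hD : DicksonFibration.DimOne) : Literature.NumberTheory.LFunctions.NoSiegelZeros :=
  noSiegelZeros_of_not_unboundedSiegelZeros fun hU => not_dimOne_of_unboundedSiegelZeros hMM hU hD

/-! ## §S Strengthen: `S⁺` = power-saving Dickson–Hardy–Littlewood -/

/-- `S⁺`: for every `t, L` some `δ > 0` with error `≤ N^{1-δ}` uniformly (power saving).  The census
explains why the added rigidity buys nothing: there is no parameter along which a power saving closes
an induction (`t ↦ t+1` re-imports coefficient growth / power-modulus Siegel–Walfisz; `N ↦ 2N` has no
recurrence), and every catalogued binary barrier is insensitive to the demanded error size. [folklore] -/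
def PowerSavingDimOne : Prop :=
  ∀ (t L : ℕ), 1 ≤ t → ∃ δ : ℝ, 0 < δ ∧ ∃ N₀ : ℕ, ∀ N : ℕ, N₀ ≤ N →
    ∀ Ψ : Fin t → AffLinForm 1, IsNondegenerateSystem Ψ → affLinSize Ψ N ≤ L →
      ∀ K : Set (Fin 1 → ℝ), Convex ℝ K → K ⊆ realBox 1 N →
        |vonMangoldtSum Ψ K N - archFactor Ψ K * singularProduct Ψ| ≤ (N : ℝ) ^ (1 - δ)

/-- `S⁺ → S`. [folklore] -/
theorem dimOne_of_powerSavingDimOne (h : PowerSavingDimOne) : DicksonFibration.DimOne := by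
  intro t L ht ε hε
  obtain ⟨δ, hδ, N₀, hN₀⟩ := h t L ht
  -- eventually `N^{1-δ} ≤ ε N`
  have hev : ∀ᶠ N : ℕ in Filter.atTop, ((N : ℝ) ^ (1 - δ)) ≤ ε * (N : ℝ) := by
    have h0 : Filter.Tendsto (fun x : ℝ => x ^ (-δ)) Filter.atTop (nhds 0) :=
      tendsto_rpow_neg_atTop hδ
    have h1 : ∀ᶠ x : ℝ in Filter.atTop, x ^ (-δ) ≤ ε :=
      (h0.eventually (ge_mem_nhds hε)).mono fun _ hx => hx
    have h2 := (h1.and (Filter.eventually_ge_atTop 1))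
    obtain ⟨X, hX⟩ := Filter.eventually_atTop.mp h2
    obtain ⟨M, hM⟩ := exists_nat_ge X
    refine Filter.eventually_atTop.mpr ⟨M, fun N hN => ?_⟩
    have hNX : X ≤ (N : ℝ) := le_trans hM (by exact_mod_cast hN)
    obtain ⟨hle, h1le⟩ := hX (N : ℝ) hNX
    have hNpos : (0 : ℝ) < N := by linarith
    calc (N : ℝ) ^ (1 - δ) = (N : ℝ) ^ (1 : ℝ) * (N : ℝ) ^ (-δ) := by
          rw [← Real.rpow_add hNpos]; ring_nf
      _ = (N : ℝ) * (N : ℝ) ^ (-δ) := by rw [Real.rpow_one]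
      _ ≤ (N : ℝ) * ε := by exact mul_le_mul_of_nonneg_left hle hNpos.le
      _ = ε * (N : ℝ) := by ring
  obtain ⟨N₁, hN₁⟩ := Filter.eventually_atTop.mp hev
  refine ⟨max N₀ N₁, fun N hN Ψ hΨ hL K hK hKN => ?_⟩
  exact le_trans (hN₀ N (le_of_max_le_left hN) Ψ hΨ hL K hK hKN) (hN₁ N (le_of_max_le_right hN))

/-! ## §D Decomposition candidates (typed; glue proved where it is logic) -/

/-- (D-a, on record in route `LeeYangFibres`): `DimOne ⟸ RelativeDimOne ∧ AbsoluteUpgrade`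
(stmt-Parity-14113 ∧ stmt-Parity-14116); glue = modus ponens. [folklore] -/
theorem dimOne_of_relative_and_upgrade (hR : LeeYangFibres.RelativeDimOne)
    (hU : LeeYangFibres.AbsoluteUpgrade) : DicksonFibration.DimOne :=
  fun t L ht ε hε => hU hR t L ht ε hε

/-- (D-b) the Siegel-dichotomy split: piece 2. [folklore] -/
def DimOneFromNoSiegel : Prop :=
  Literature.NumberTheory.LFunctions.NoSiegelZeros → DicksonFibration.DimOne

/-- (D-b) glue: `NoSiegelZeros → (NoSiegelZeros → DimOne) → DimOne`; piece 1 is NECESSARY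
(`noSiegelZeros_of_dimOne`), piece 2 is the crux under a believed hypothesis. [folklore] -/
theorem dimOne_of_siegelSplit (h₁ : Literature.NumberTheory.LFunctions.NoSiegelZeros)
    (h₂ : DimOneFromNoSiegel) : DicksonFibration.DimOne := h₂ h₁

/-- (D-c) shift-range partition, small side: all constant terms `≤ B(N)` in absolute value
(fixed-pattern / prime `k`-tuple sector; Goldbach-in-the-shift excluded when `B(N) = o(N)`). [folklore] -/
def DimOneShiftLE (B : ℕ → ℕ) : Prop :=
  ∀ (t L : ℕ), 1 ≤ t → ∀ ε : ℝ, 0 < ε → ∃ N₀ : ℕ, ∀ N : ℕ, N₀ ≤ N →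
    ∀ Ψ : Fin t → AffLinForm 1, IsNondegenerateSystem Ψ → affLinSize Ψ N ≤ L →
      (∀ i, |(Ψ i).const| ≤ ((B N : ℕ) : ℤ)) →
      ∀ K : Set (Fin 1 → ℝ), Convex ℝ K → K ⊆ realBox 1 N →
        |vonMangoldtSum Ψ K N - archFactor Ψ K * singularProduct Ψ| ≤ ε * (N : ℝ)

/-- (D-c) shift-range partition, large side: some constant term exceeds `B(N)` (contains binary
Goldbach for every even `M ∈ (B(N), LN]` and the Siegel-sensitive family `(n, n + 2q)`). [folklore] -/
def DimOneShiftGT (B : ℕ → ℕ) : Prop :=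
  ∀ (t L : ℕ), 1 ≤ t → ∀ ε : ℝ, 0 < ε → ∃ N₀ : ℕ, ∀ N : ℕ, N₀ ≤ N →
    ∀ Ψ : Fin t → AffLinForm 1, IsNondegenerateSystem Ψ → affLinSize Ψ N ≤ L →
      (∃ i, ((B N : ℕ) : ℤ) < |(Ψ i).const|) →
      ∀ K : Set (Fin 1 → ℝ), Convex ℝ K → K ⊆ realBox 1 N →
        |vonMangoldtSum Ψ K N - archFactor Ψ K * singularProduct Ψ| ≤ ε * (N : ℝ)

/-- (D-c) glue: the two sectors partition the systems, so they reassemble `DimOne` with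
`N₀ = max`. [folklore] -/
theorem dimOne_of_shiftPartition (B : ℕ → ℕ) (h₁ : DimOneShiftLE B) (h₂ : DimOneShiftGT B) :
    DicksonFibration.DimOne := by
  intro t L ht ε hε
  obtain ⟨N₁, hN₁⟩ := h₁ t L ht ε hε
  obtain ⟨N₂, hN₂⟩ := h₂ t L ht ε hε
  refine ⟨max N₁ N₂, fun N hN Ψ hΨ hL K hK hKN => ?_⟩
  by_cases hB : ∀ i, |(Ψ i).const| ≤ ((B N : ℕ) : ℤ)
  · exact hN₁ N (le_of_max_le_left hN) Ψ hΨ hL hB K hK hKN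
  · push_neg at hB
    exact hN₂ N (le_of_max_le_right hN) Ψ hΨ hL hB K hK hKN

/-- (D-c) converse bookkeeping: each sector is a slice of the crux. [folklore] -/
theorem shiftLE_of_dimOne (B : ℕ → ℕ) (h : DicksonFibration.DimOne) : DimOneShiftLE B := by
  intro t L ht ε hε
  obtain ⟨N₀, hN₀⟩ := h t L ht ε hε
  exact ⟨N₀, fun N hN Ψ hΨ hL _ K hK hKN => hN₀ N hN Ψ hΨ hL K hK hKN⟩

theorem shiftGT_of_dimOne (B : ℕ → ℕ) (h : DicksonFibration.DimOne) : DimOneShiftGT B := by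
  intro t L ht ε hε
  obtain ⟨N₀, hN₀⟩ := h t L ht ε hε
  exact ⟨N₀, fun N hN Ψ hΨ hL _ K hK hKN => hN₀ N hN Ψ hΨ hL K hK hKN⟩

end

end Summit.Parity.GeneralizedHardyLittlewood.Cruxes.DimOne.Strategist
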